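import Literature.NumberTheory.EllipticCurves.Gamma0RankinSelbergUnfoldingSigned
import Literature.NumberTheory.EllipticCurves.Gamma0EisensteinWeightOne
import HarnessLib

/-!
# Rankin–Selberg unfolding of a weight-2 form against a weight-1 form and `E₁,ψ(·, s)`

Topic `Literature/NumberTheory/EllipticCurves`; namespace
`Literature.NumberTheory.EllipticCurves.ModularForms`. One definition with a body (`rsIntegrand`)
and theorems; no named fact.

Let `ψ` be a Dirichlet character mod `N`, `φ : ℍ → ℂ` of weight `2` and trivial character on
`Γ₀(N)` (`φ(Aτ) = j(A,τ)² φ(τ)`), `F : ℍ → ℂ` of weight `1` and character `ψ`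
(`F(Aτ) = ψ(d) j(A,τ) F(τ)`), and `E₁,ψ(τ, s) = ∑_{(c,d)=1, N∣c} ψ(d) (cτ+d)⁻¹ (Im τ/|cτ+d|²)ˢ`
the tree's weight-one Eisenstein series (`eisensteinOne ψ`, `Gamma0EisensteinWeightOne.lean`).
The function `Φ(τ) = φ(τ) \overline{F(τ)} \overline{E₁,ψ(τ, s̄)} (Im τ)²` is then `Γ₀(N)`-invariant,
and the Rankin–Selberg method unfolds its integral over `Γ₀(N)\ℍ`:

* `rsIntegrand φ F s w = φ(w) \overline{F(w)} (Im w)^{s+2}` — the unfolded integrand;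
* `conj_e1Term_mul_eq` — **the term identity** (the "one-line computation"): for `A ∈ Γ₀(N)` with
  bottom row `(c, d)`,
  `\overline{ψ(d)(cτ+d)⁻¹(Im τ/|cτ+d|²)^{s̄}} · φ(τ) \overline{F(τ)} (Im τ)² = rsIntegrand(Aτ)`;
* `conj_eisensteinOne_mul_eq_tsum` — summing: `\overline{E₁,ψ(τ, s̄)} φ F̄ y² = ∑_v rsIntegrand(γ_v τ)`
  for any section `v ↦ γ_v ∈ Γ₀(N)` of the bottom-row map (every `s`; no convergence needed);
* `rsIntegrand_T_zpow_smul` — `rsIntegrand` is `T`-periodic;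
* `integral_domain_conj_eisensteinOne_mul_eq` — **the unfolding**: with the tree's fundamental
  domain `F = ⋃_q g_q⁻¹ 𝒟ᵒ` of `Γ₀(N)` and the strip `P = {0 ≤ Re < 1}`, whenever
  `∫_P |φ F̄| y^{Re s + 2} dμ < ∞`,
  `∫_F φ \overline{F} \overline{E₁,ψ(·, s̄)} y² dμ = 2 ∫_P φ \overline{F} y^{s+2} dμ`
  (`dμ = dx dy/y²`; the tree's signed unfolding `integral_domain_tsum_comp_smul_eq`).

(Rankin 1939, §4; Shimura 1976, (2.3)–(2.4).) Combined with the strip integral of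
`RankinSelbergBilinearStrip.lean` the right-hand side is `2Γ(s+1)(4π)^{-s-1} ∑ a(m)\overline{b(m)}
m^{-s-1}` for the `q`-coefficients `a, b` of `φ, F`.

## References

* R. A. Rankin, Proc. Cambridge Philos. Soc. 35 (1939), 357–372, §4.
* G. Shimura, *The special values of the zeta functions associated with cusp forms*, Comm. Pure
  Appl. Math. 29 (1976), §2.
-/

noncomputable section

open scoped MatrixGroups ModularForm Modular ENNReal NNReal ComplexConjugate
open MeasureTheory Set Filter ModularGroup CongruenceSubgroup
open UpperHalfPlane hiding I

namespace Literature.NumberTheory.EllipticCurves.ModularForms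

/-- The integer matrix of an element of `SL(2, ℤ)` (Mathlib's local notation). -/
local notation:1024 "↑ₘ" A:1024 => ((A : SL(2, ℤ)) : Matrix (Fin 2) (Fin 2) ℤ)

variable {N : ℕ} (ψ : DirichletCharacter ℂ N)

/-- The unfolded Rankin–Selberg integrand `φ(w) \overline{F(w)} (Im w)^{s+2}`. [folklore] -/
def rsIntegrand (φ F : ℍ → ℂ) (s : ℂ) (w : ℍ) : ℂ :=
  φ w * conj (F w) * ((w.im : ℝ) : ℂ) ^ (s + 2)

/-! ### The term identity -/

/-- `ψ(d) ≠ 0` for the bottom row `(c, d)` of an element of `Γ₀(N)` (`(c, d) = 1`, `N ∣ c`).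
[folklore] -/
theorem chi_ne_zero_of_isCoprime {v : Fin 2 → ℤ} (hv : IsCoprime (v 0) (v 1))
    (hv0 : (N : ℤ) ∣ v 0) : ψ (v 1) ≠ 0 := by
  obtain ⟨a, b, hab⟩ := hv
  have hu : IsUnit ((v 1 : ℤ) : ZMod N) := by
    refine isUnit_iff_exists_inv.mpr ⟨(b : ZMod N), ?_⟩
    have h : ((a * v 0 + b * v 1 : ℤ) : ZMod N) = 1 := by rw [hab]; simp
    have h0 : ((v 0 : ℤ) : ZMod N) = 0 := (ZMod.intCast_zmod_eq_zero_iff_dvd _ _).mpr hv0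
    push_cast at h
    rw [h0, mul_zero, zero_add] at h
    rw [mul_comm]; exact h
  exact (hu.map ψ).ne_zero

/-- `conj((r : ℂ)^{s̄}) = (r : ℂ)ˢ` for real `r ≥ 0`. [folklore] -/
theorem conj_ofReal_cpow_conj {r : ℝ} (hr : 0 ≤ r) (s : ℂ) :
    conj (((r : ℝ) : ℂ) ^ conj s) = ((r : ℝ) : ℂ) ^ s := by
  have harg : ((r : ℝ) : ℂ).arg ≠ Real.pi := by
    rw [Complex.arg_ofReal_of_nonneg hr]; exact Real.pi_pos.ne
  rw [Complex.cpow_conj _ _ harg, Complex.conj_conj, Complex.conj_ofReal]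

/-- **The term identity.** For `A ∈ SL₂(ℤ)` with `N ∣ c` (bottom row `(c, d)`), `φ` of weight 2
and `F` of weight 1 and character `ψ` under `A`:
`\overline{e_{(c,d)}^{ψ}(τ, s̄)} · φ(τ) \overline{F(τ)} (Im τ)² = φ(Aτ) \overline{F(Aτ)} (Im Aτ)^{s+2}`.
[folklore] -/
theorem conj_e1Term_mul_eq (φ F : ℍ → ℂ) (A : SL(2, ℤ)) (hA0 : (N : ℤ) ∣ A 1 0)
    (hφ : ∀ τ : ℍ, φ (A • τ) = denom A τ ^ 2 * φ τ)
    (hF : ∀ τ : ℍ, F (A • τ) = ψ (A 1 1) * denom A τ * F τ) (s : ℂ) (τ : ℍ) :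
    conj (e1Term ψ (conj s) (fun i ↦ A 1 i) τ) * (φ τ * conj (F τ) * ((τ.im : ℝ) : ℂ) ^ 2) =
      rsIntegrand φ F s (A • τ) := by
  have hcop : IsCoprime (A 1 0) (A 1 1) := by
    have hdet := Matrix.SpecialLinearGroup.det_coe A
    rw [Matrix.det_fin_two] at hdet
    refine ⟨-(A 0 1), A 0 0, ?_⟩
    linear_combination hdet
  have hψ : ψ (A 1 1) ≠ 0 := chi_ne_zero_of_isCoprime ψ (v := fun i ↦ A 1 i) hcop hA0
  set j : ℂ := denom A τ with hj
  have hD : j ≠ 0 := denom_ne_zero A τ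
  have hDc : conj j ≠ 0 := (map_ne_zero_iff (starRingEnd ℂ) (RingHom.injective _)).mpr hD
  have hjdef : ((A 1 0 : ℤ) : ℂ) * (τ : ℂ) + ((A 1 1 : ℤ) : ℂ) = j := by
    rw [hj, ModularGroup.denom_apply]
  have hn : Complex.normSq j ≠ 0 := by rwa [Ne, Complex.normSq_eq_zero]
  have hn' : ((Complex.normSq j : ℝ) : ℂ) ≠ 0 := Complex.ofReal_ne_zero.mpr hn
  have him : ((((A • τ : ℍ).im : ℝ)) : ℂ) * (j * conj j) = ((τ.im : ℝ) : ℂ) := by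
    rw [Complex.mul_conj, ModularGroup.im_smul_eq_div_normSq, ← hj]
    push_cast
    exact div_mul_cancel₀ _ hn'
  have him0 : ((((A • τ : ℍ).im : ℝ)) : ℂ) ≠ 0 := Complex.ofReal_ne_zero.mpr (A • τ).im_pos.ne'
  have hbase : e1Base (fun i ↦ A 1 i) τ = (A • τ : ℍ).im := by
    unfold e1Base
    rw [hjdef, ModularGroup.im_smul_eq_div_normSq, Complex.normSq_eq_norm_sq]
  unfold rsIntegrand e1Term
  rw [hjdef, hbase, hφ τ, hF τ, ← hj]
  simp only [map_mul, map_inv₀, conj_ofReal_cpow_conj (A • τ).im_pos.le]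
  rw [Complex.cpow_add _ _ him0, Complex.cpow_ofNat]
  rw [← him]
  field_simp

/-! ### Summing over the bottom rows -/

section Sum

variable (γ : {v : Fin 2 → ℤ // IsCoprime (v 0) (v 1) ∧ (N : ℤ) ∣ v 0} → SL(2, ℤ))
  (hγ : ∀ v, (γ v) 1 0 = v.1 0 ∧ (γ v) 1 1 = v.1 1)
include hγ

/-- Each `γ_v` lies in `Γ₀(N)`. [folklore] -/
theorem rowSection_mem_Gamma0 (v : {v : Fin 2 → ℤ // IsCoprime (v 0) (v 1) ∧ (N : ℤ) ∣ v 0}) :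
    γ v ∈ Gamma0 N := by
  rw [Gamma0_mem]
  have h : (γ v) 1 0 = v.1 0 := (hγ v).1
  rw [show ((↑ₘ(γ v) 1 0 : ℤ) : ZMod N) = ((v.1 0 : ℤ) : ZMod N) by rw [← h]]
  exact (ZMod.intCast_zmod_eq_zero_iff_dvd _ _).mpr v.2.2

/-- **Summing the term identity**: for every `s` (no convergence needed),
`\overline{E₁,ψ(τ, s̄)} · φ(τ) \overline{F(τ)} (Im τ)² = ∑_v rsIntegrand(γ_v τ)`. [folklore] -/
theorem conj_eisensteinOne_mul_eq_tsum (φ F : ℍ → ℂ)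
    (hφ : ∀ A : SL(2, ℤ), A ∈ Gamma0 N → ∀ τ : ℍ, φ (A • τ) = denom A τ ^ 2 * φ τ)
    (hF : ∀ A : SL(2, ℤ), A ∈ Gamma0 N → ∀ τ : ℍ, F (A • τ) = ψ (A 1 1) * denom A τ * F τ)
    (s : ℂ) (τ : ℍ) :
    conj (eisensteinOne ψ τ (conj s)) * (φ τ * conj (F τ) * ((τ.im : ℝ) : ℂ) ^ 2) =
      ∑' v : {v : Fin 2 → ℤ // IsCoprime (v 0) (v 1) ∧ (N : ℤ) ∣ v 0}, rsIntegrand φ F s (γ v • τ) := by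
  unfold eisensteinOne
  rw [Complex.conj_tsum, ← tsum_mul_right]
  refine tsum_congr fun v ↦ ?_
  have hmem := rowSection_mem_Gamma0 γ hγ v
  have h0 : (N : ℤ) ∣ (γ v) 1 0 := by rw [(hγ v).1]; exact v.2.2
  have hv : (v : Fin 2 → ℤ) = fun i ↦ (γ v) 1 i := by
    ext i
    fin_cases i
    · exact (hγ v).1.symm
    · exact (hγ v).2.symm
  rw [hv]
  exact conj_e1Term_mul_eq ψ φ F (γ v) h0 (hφ _ hmem) (hF _ hmem) s τ

end Sum

/-! ### Periodicity and the unfolding -/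

/-- `T ^ n ∈ Γ₀(N)` for `n ∈ ℤ`, with bottom row `(0, 1)`. [folklore] -/
theorem T_zpow_int_mem_Gamma0 (n : ℤ) : (T ^ n : SL(2, ℤ)) ∈ Gamma0 N := by
  rw [Gamma0_mem, ModularGroup.coe_T_zpow]
  simp

/-- The `(1,0)` entry of `Tⁿ` is `0`. [folklore] -/
theorem T_zpow_one_zero (n : ℤ) : (T ^ n : SL(2, ℤ)) 1 0 = 0 := by
  rw [show (T ^ n : SL(2, ℤ)) 1 0 = (↑ₘ(T ^ n)) 1 0 from rfl, ModularGroup.coe_T_zpow]; simp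

/-- The `(1,1)` entry of `Tⁿ` is `1`. [folklore] -/
theorem T_zpow_one_one (n : ℤ) : (T ^ n : SL(2, ℤ)) 1 1 = 1 := by
  rw [show (T ^ n : SL(2, ℤ)) 1 1 = (↑ₘ(T ^ n)) 1 1 from rfl, ModularGroup.coe_T_zpow]; simp

/-- `j(Tⁿ, ρ) = 1`. [folklore] -/
theorem denom_T_zpow (n : ℤ) (ρ : ℍ) : denom (T ^ n : SL(2, ℤ)) ρ = 1 := by
  rw [ModularGroup.denom_apply, T_zpow_one_zero, T_zpow_one_one]; simp

/-- **`T`-periodicity of the unfolded integrand.** [folklore] -/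
theorem rsIntegrand_T_zpow_smul (φ F : ℍ → ℂ)
    (hφ : ∀ A : SL(2, ℤ), A ∈ Gamma0 N → ∀ τ : ℍ, φ (A • τ) = denom A τ ^ 2 * φ τ)
    (hF : ∀ A : SL(2, ℤ), A ∈ Gamma0 N → ∀ τ : ℍ, F (A • τ) = ψ (A 1 1) * denom A τ * F τ)
    (s : ℂ) (n : ℤ) (ρ : ℍ) :
    rsIntegrand φ F s ((T ^ n : SL(2, ℤ)) • ρ) = rsIntegrand φ F s ρ := by
  unfold rsIntegrand
  rw [hφ _ (T_zpow_int_mem_Gamma0 n) ρ, hF _ (T_zpow_int_mem_Gamma0 n) ρ, denom_T_zpow,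
    T_zpow_one_one, UpperHalfPlane.modular_T_zpow_smul, UpperHalfPlane.vadd_im]
  simp

/-- The unfolded integrand is measurable when `φ` and `F` are. [folklore] -/
theorem measurable_rsIntegrand {φ F : ℍ → ℂ} (hφm : Measurable φ) (hFm : Measurable F) (s : ℂ) :
    Measurable (rsIntegrand φ F s) := by
  unfold rsIntegrand
  refine (hφm.mul (Complex.continuous_conj.measurable.comp hFm)).mul ?_
  exact (Complex.measurable_ofReal.comp UpperHalfPlane.continuous_im.measurable).pow_const _

section Unfolding

variable (g : (↥𝒮ℒ ⧸ (Gamma0 N : Subgroup (GL (Fin 2) ℝ)).subgroupOf 𝒮ℒ) → SL(2, ℤ))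
  (hg : ∀ q, (Matrix.SpecialLinearGroup.mapGL ℝ (g q) : GL (Fin 2) ℝ) =
    ((q.out : ↥𝒮ℒ) : GL (Fin 2) ℝ))
variable (γ : {v : Fin 2 → ℤ // IsCoprime (v 0) (v 1) ∧ (N : ℤ) ∣ v 0} → SL(2, ℤ))
  (hγ : ∀ v, (γ v) 1 0 = v.1 0 ∧ (γ v) 1 1 = v.1 1)
variable [Fintype (↥𝒮ℒ ⧸ (Gamma0 N : Subgroup (GL (Fin 2) ℝ)).subgroupOf 𝒮ℒ)]
include hg hγ

/-- **Rankin–Selberg unfolding for `(φ, F, E₁,ψ)`**: for `φ` of weight `2`, `F` of weight `1`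
and character `ψ` on `Γ₀(N)` (both measurable) and `s` with `∫_P |φ F̄| y^{Re s+2} dμ < ∞`,
`∫_F φ F̄ \overline{E₁,ψ(·, s̄)} y² dμ = 2 ∫_P φ F̄ y^{s+2} dμ` (`F` the tree's fundamental domain
of `Γ₀(N)`, `P = {0 ≤ Re < 1}`, `dμ = dx dy/y²`). [folklore] -/
theorem integral_domain_conj_eisensteinOne_mul_eq [NeZero N] (φ F : ℍ → ℂ)
    (hφm : Measurable φ) (hFm : Measurable F)
    (hφ : ∀ A : SL(2, ℤ), A ∈ Gamma0 N → ∀ τ : ℍ, φ (A • τ) = denom A τ ^ 2 * φ τ)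
    (hF : ∀ A : SL(2, ℤ), A ∈ Gamma0 N → ∀ τ : ℍ, F (A • τ) = ψ (A 1 1) * denom A τ * F τ)
    (s : ℂ) (hfin : ∫⁻ ρ in {ρ : ℍ | 0 ≤ ρ.re ∧ ρ.re < 1}, ‖rsIntegrand φ F s ρ‖ₑ < ∞) :
    ∫ τ in ⋃ q, {τ : ℍ | g q • τ ∈ 𝒟ᵒ},
        conj (eisensteinOne ψ τ (conj s)) * (φ τ * conj (F τ) * ((τ.im : ℝ) : ℂ) ^ 2) =
      2 * ∫ ρ in {ρ : ℍ | 0 ≤ ρ.re ∧ ρ.re < 1}, rsIntegrand φ F s ρ := by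
  rw [setIntegral_congr_fun (measurableSet_domain g)
    (fun τ _ ↦ conj_eisensteinOne_mul_eq_tsum ψ γ hγ φ F hφ hF s τ)]
  exact integral_domain_tsum_comp_smul_eq g hg γ hγ (rsIntegrand φ F s)
    (measurable_rsIntegrand hφm hFm s) (rsIntegrand_T_zpow_smul ψ φ F hφ hF s) hfin

end Unfolding

end Literature.NumberTheory.EllipticCurves.ModularForms
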